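import Mathlib.LinearAlgebra.Matrix.GeneralLinearGroup.Projective
import Literature.NumberTheory.GaloisRepresentations.ResidualGaloisRep
import Literature.NumberTheory.GaloisRepresentations.TateUnramifiedLiftingHolds
import Literature.NumberTheory.GaloisRepresentations.GoodDihedralLocalImage
import Literature.RepresentationTheory.Semisimple.BurnsideMatrixSpan
import Literature.RingTheory.Valuation.AlgClosedResidue
import HarnessLib

/-!
# Stub D `stub_twistedAdjointOfGO3` (line `birth`, crux `AdjointSeedFromDuality`)

Galois-side assembly of the exceptional isomorphism `SO₃ ≅ PGL₂` (stmt-Langlands-16780): a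
residual `ρ̄ : Γ_ℚ → GL₃(k)` (`k = ℤ̄_p/𝔪`, open kernel, absolutely irreducible) with
`ρ̄(σ)ᵀ A ρ̄(σ) = ν̄(σ) A` (`A` invertible) is a twist `ψ̄ ⊗ ad⁰ τ̄` of the trace-zero adjoint of
a `GL₂(k)`-valued `τ̄` with open kernel, absolutely irreducible:
`tr ρ̄(σ) = ψ̄(σ) (tr τ̄(σ)² / det τ̄(σ) − 1)` — GIVEN (hypothesis `hAd`) the surjectivity half
of the exceptional isomorphism.  Coordinates: `v : Fin 3 → k` names the trace-zero matrix
`X_v := !![v 1, v 0; v 2, -v 1]`.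

Proof: `μ := det ρ̄ · ν̄⁻¹` has `μ² = ν̄`, `μ³ = det ρ̄`, so `M_σ := μ(σ)⁻¹ ρ̄(σ) ∈ SO(A)` and `hAd`
gives `g_σ ∈ GL₂(k)` with `g_σ X_v g_σ⁻¹ = X_{N_σ v}`, `N_σ := T⁻¹ M_σ T` multiplicative in `σ`;
`ker Ad = centre` makes `σ ↦ [g_σ] ∈ PGL₂(k)` a homomorphism with kernel `⊇ ker ρ̄`; Tate's
theorem (`Tate_projectiveLifting_holds`, `k` algebraically closed with the discrete topology)
lifts it to a continuous `τ̄`, so `Ad(τ̄ σ) = N_σ` in coordinates; `tr N = tr(h)²/det h − 1`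
for `Ad(h) = N`; an eigenvector `u` of all `τ̄(σ)` would give the common eigenvector
`T (u₀², −u₀u₁, −u₁²)` of all `ρ̄(σ)`; over the algebraically closed `k` irreducibility is
absolute irreducibility (Burnside).
-/

set_option linter.dupNamespace false -- `Summit.Langlands.Langlands` is the mandated namespace

namespace Summit.Langlands.Langlands.Cruxes.AdjointSeedFromDuality.Birth

open scoped MatrixGroups
open Literature.NumberTheory.GaloisRepresentations

section AdKernel

variable {k : Type*} [Field k]

/-- `ker Ad = centre`: an element of `GL₂(k)` whose conjugation fixes every trace-zero matrix
`X_v` is central (it commutes with `E = X_{e₀}` and `F = X_{e₂}`). [folklore] -/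
private theorem mem_center_of_conj_eq (z : GL (Fin 2) k)
    (h : ∀ v : Fin 3 → k, z.val * !![v 1, v 0; v 2, -v 1] * z⁻¹.val = !![v 1, v 0; v 2, -v 1]) :
    z ∈ Subgroup.center (GL (Fin 2) k) := by
  rw [Matrix.GeneralLinearGroup.mem_center_iff_val_mem_range_scalar]
  have key : ∀ v : Fin 3 → k, z.val * !![v 1, v 0; v 2, -v 1] =
      !![v 1, v 0; v 2, -v 1] * z.val := fun v => by
    calc z.val * !![v 1, v 0; v 2, -v 1]
        = z.val * !![v 1, v 0; v 2, -v 1] * z⁻¹.val * z.val := by rw [Units.inv_mul_cancel_right]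
      _ = !![v 1, v 0; v 2, -v 1] * z.val := by rw [h v]
  have h00 := congr_fun (congr_fun (key ![1, 0, 0]) 0) 0
  have h01 := congr_fun (congr_fun (key ![1, 0, 0]) 0) 1
  have h00' := congr_fun (congr_fun (key ![0, 0, 1]) 0) 0
  simp [Matrix.mul_apply, Fin.sum_univ_two] at h00 h01 h00'
  refine ⟨z.val 0 0, ?_⟩
  ext i j
  fin_cases i <;> fin_cases j <;> simp [h00, h01, h00']

/-- Uniqueness of `Ad`-preimages up to the centre: if `g₁` and `g₂` induce the same conjugation
action on the trace-zero matrices, they have the same image in `PGL₂(k)`. [folklore] -/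
private theorem mk_eq_mk_of_conj_eq (g₁ g₂ : GL (Fin 2) k)
    (h : ∀ v : Fin 3 → k, g₁.val * !![v 1, v 0; v 2, -v 1] * g₁⁻¹.val =
      g₂.val * !![v 1, v 0; v 2, -v 1] * g₂⁻¹.val) :
    Matrix.ProjGenLinGroup.mk g₁ = Matrix.ProjGenLinGroup.mk g₂ := by
  rw [Matrix.ProjGenLinGroup.mk_eq_mk_iff']
  refine ⟨g₁⁻¹ * g₂, mem_center_of_conj_eq _ fun v => ?_, by rw [mul_inv_cancel_left]⟩
  rw [mul_inv_rev, inv_inv, Units.val_mul, Units.val_mul]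
  calc g₁⁻¹.val * g₂.val * !![v 1, v 0; v 2, -v 1] * (g₂⁻¹.val * g₁.val)
      = g₁⁻¹.val * (g₂.val * !![v 1, v 0; v 2, -v 1] * g₂⁻¹.val) * g₁.val := by
        simp only [Matrix.mul_assoc]
    _ = !![v 1, v 0; v 2, -v 1] := by
        rw [← h v]
        simp only [Matrix.mul_assoc]
        rw [Units.inv_mul, Matrix.mul_one, Units.inv_mul_cancel_left]

/-- Conversely, elements of `GL₂(k)` with the same image in `PGL₂(k)` induce the same
conjugation. [folklore] -/
private theorem conj_eq_of_mk_eq {g₁ g₂ : GL (Fin 2) k}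
    (h : Matrix.ProjGenLinGroup.mk g₁ = Matrix.ProjGenLinGroup.mk g₂) (X : Matrix (Fin 2) (Fin 2) k) :
    g₁.val * X * g₁⁻¹.val = g₂.val * X * g₂⁻¹.val := by
  obtain ⟨u, rfl⟩ := Matrix.ProjGenLinGroup.mk_eq_mk_iff.mp h
  have h1 : (g₁ * Matrix.GeneralLinearGroup.scalar (Fin 2) u).val = (u : k) • g₁.val := by
    rw [Units.val_mul, Matrix.GeneralLinearGroup.coe_scalar, Matrix.scalar_apply,
      ← Matrix.smul_eq_mul_diagonal]
  have h2 : (g₁ * Matrix.GeneralLinearGroup.scalar (Fin 2) u)⁻¹.val = (u⁻¹ : kˣ).val • g₁⁻¹.val := by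
    rw [mul_inv_rev, ← map_inv, Units.val_mul, Matrix.GeneralLinearGroup.coe_scalar,
      Matrix.scalar_apply, ← Matrix.smul_eq_diagonal_mul]
  rw [h1, h2, Matrix.smul_mul, Matrix.smul_mul, Matrix.mul_smul, smul_smul,
    Units.val_inv_eq_inv_val, mul_inv_cancel₀ u.ne_zero, one_smul]

/-- The inverse of `h ∈ GL₂(k)` as a matrix: `(det h)⁻¹ • adj h`. [folklore] -/
private theorem coe_inv_two (h : GL (Fin 2) k) : h⁻¹.val =
    (h.val.det)⁻¹ • !![h.val 1 1, -h.val 0 1; -h.val 1 0, h.val 0 0] := by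
  rw [Matrix.coe_units_inv, Matrix.inv_def, Ring.inverse_eq_inv, Matrix.adjugate_fin_two]

/-- `tr Ad(h) = tr(h)² / det h − 1`: if conjugation by `h ∈ GL₂(k)` acts on the coordinates of
the trace-zero matrices through the `3 × 3` matrix `N`, then `tr N = tr(h)² / det h − 1`.
[folklore] -/
private theorem trace_eq_of_conj_eq (h : GL (Fin 2) k) (N : Matrix (Fin 3) (Fin 3) k)
    (hN : ∀ v : Fin 3 → k, h.val * !![v 1, v 0; v 2, -v 1] * h⁻¹.val =
      !![(N.mulVec v) 1, (N.mulVec v) 0; (N.mulVec v) 2, -(N.mulVec v) 1]) :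
    N.trace = h.val.trace ^ 2 * (h.val.det)⁻¹ - 1 := by
  have hD : h.val.det ≠ 0 := Matrix.GeneralLinearGroup.det_ne_zero h
  have hinv := coe_inv_two h
  have hE := congr_fun (congr_fun (hN ![1, 0, 0]) 0) 1
  have hH := congr_fun (congr_fun (hN ![0, 1, 0]) 0) 0
  have hF := congr_fun (congr_fun (hN ![0, 0, 1]) 1) 0
  simp [hinv, Matrix.mul_apply, Fin.sum_univ_two, Matrix.mulVec, dotProduct,
    Fin.sum_univ_three] at hE hH hF
  rw [Matrix.trace_fin_three, Matrix.trace_fin_two, ← hE, ← hH, ← hF]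
  rw [Matrix.det_fin_two] at hD ⊢
  field_simp
  ring

/-- **Eigenvectors pass to `Ad`.**  An eigenvector `u` of `h ∈ GL₂(k)` (`h u = c u`) gives the
eigenvector `(u₀², −u₀u₁, −u₁²)` — the coordinates of `X = u · u^⊥`, `u^⊥ = (−u₁, u₀)` — of the
matrix `N` of `Ad(h)` in the coordinates `v ↦ X_v`, with eigenvalue `c² / det h`
(`h X = c X` and `X adj(h) = c X`). [folklore] -/
private theorem ad_mulVec_eq_smul (h : GL (Fin 2) k) (N : Matrix (Fin 3) (Fin 3) k)
    (hN : ∀ v : Fin 3 → k, h.val * !![v 1, v 0; v 2, -v 1] * h⁻¹.val =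
      !![(N.mulVec v) 1, (N.mulVec v) 0; (N.mulVec v) 2, -(N.mulVec v) 1])
    (u : Fin 2 → k) (c : k) (hu : h.val.mulVec u = c • u) :
    N.mulVec ![u 0 ^ 2, -(u 0 * u 1), -(u 1 ^ 2)] =
      (c ^ 2 * (h.val.det)⁻¹) • ![u 0 ^ 2, -(u 0 * u 1), -(u 1 ^ 2)] := by
  have e0 := congr_fun hu 0
  have e1 := congr_fun hu 1
  simp [Matrix.mulVec, dotProduct, Fin.sum_univ_two] at e0 e1
  have key := hN ![u 0 ^ 2, -(u 0 * u 1), -(u 1 ^ 2)]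
  rw [coe_inv_two] at key
  generalize N.mulVec ![u 0 ^ 2, -(u 0 * u 1), -(u 1 ^ 2)] = w at key ⊢
  have k0 := congr_fun (congr_fun key 0) 1
  have k1 := congr_fun (congr_fun key 0) 0
  have k2 := congr_fun (congr_fun key 1) 0
  simp [Matrix.mul_apply, Fin.sum_univ_two] at k0 k1 k2
  ext i
  fin_cases i
  · simp
    linear_combination -k0 +
      (h.val.det)⁻¹ * (h.val 0 0 * u 0 + h.val 0 1 * u 1 + c * u 0) * e0
  · simp
    linear_combination -k1 - (h.val.det)⁻¹ * (h.val 1 0 * u 0 + h.val 1 1 * u 1) * e0 -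
      (h.val.det)⁻¹ * c * u 0 * e1
  · simp
    linear_combination -k2 -
      (h.val.det)⁻¹ * (h.val 1 0 * u 0 + h.val 1 1 * u 1 + c * u 1) * e1

/-- A common eigenvector spans an invariant line, so a `GL₃(k)`-valued homomorphism with a common
eigenvector is not irreducible (rank-`3` copy of the tree's rank-`2`
`not_hasCommonEigenvector_of_isIrreducible`). [folklore] -/
private theorem not_isIrreducible_of_common_eigenvector {G : Type*} [Group G]
    (ρ : G →* GL (Fin 3) k) (v : Fin 3 → k) (hv0 : v ≠ 0)
    (key : ∀ g, ∃ a : k, (ρ g).val.mulVec v = a • v) : ¬ (glRepresentation ρ).IsIrreducible := by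
  intro hirr
  let S : Subrepresentation (glRepresentation ρ) :=
    { toSubmodule := Submodule.span k {v}
      apply_mem_toSubmodule := by
        intro g w hw
        obtain ⟨b, rfl⟩ := Submodule.mem_span_singleton.mp hw
        obtain ⟨a, ha⟩ := key g
        rw [glRepresentation_apply_apply, Matrix.mulVec_smul, ha, smul_smul]
        exact Submodule.mem_span_singleton.mpr ⟨b * a, rfl⟩ }
  rcases IsSimpleOrder.eq_bot_or_eq_top (α := Subrepresentation (glRepresentation ρ)) S with
    hS | hS
  · have hvS : v ∈ S := Submodule.mem_span_singleton_self v
    rw [hS] at hvS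
    exact hv0 ((Submodule.mem_bot k).mp hvS)
  · have h1 : Module.finrank k (Submodule.span k {v}) = 1 := finrank_span_singleton hv0
    have h2 : (Submodule.span k {v} : Submodule k (Fin 3 → k)) = ⊤ :=
      congrArg Subrepresentation.toSubmodule hS
    rw [h2, finrank_top, Module.finrank_fin_fun] at h1
    exact absurd h1 (by norm_num)

end AdKernel

/-- **STUB D — orthogonal similitude in rank 3 ⇒ twisted adjoint of a `GL₂`-valued residual
representation**, GIVEN the exceptional isomorphism (hypothesis `hAd`, the statement of STUB C for
this `A`).  For `ρ̄ : Γ_ℚ → GL₃(ℤ̄_p/𝔪)` with open kernel, absolutely irreducible, with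
`ρ̄(σ)ᵀ A ρ̄(σ) = ν̄(σ) A` (`A` invertible): there are `τ̄ : Γ_ℚ → GL₂(ℤ̄_p/𝔪)` (open
kernel, absolutely irreducible) and `ψ̄` (open kernel) with `tr ρ̄(σ) = ψ̄(σ)(tr τ̄(σ)²/det τ̄(σ) − 1)`.
Proof: `k = ℤ̄_p/𝔪` is algebraically closed (`Literature.RingTheory.Valuation.isAlgClosed_residueField`);
`det ρ̄² = ν̄³`, so `μ := det ρ̄ · ν̄⁻¹` has `μ² = ν̄`, `μ³ = det ρ̄` and
`M_σ := μ(σ)⁻¹ ρ̄(σ) ∈ SO(A)`; `hAd` gives `g_σ` with `Ad(g_σ) = N_σ := T⁻¹ M_σ T` in coordinates;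
`ker Ad = centre` (`mem_center_of_conj_eq`), so `σ ↦ [g_σ] ∈ PGL₂(k)` is a homomorphism with
kernel `⊇ ker ρ̄` (open); Tate (`Tate_projectiveLifting_holds`, discrete topology on `k`) gives a
continuous `τ̄` with `[τ̄(σ)] = [g_σ]`, hence `Ad(τ̄ σ) = N_σ`; `tr N_σ = tr(τ̄ σ)²/det τ̄(σ) − 1`
(`trace_eq_of_conj_eq`) and `tr N_σ = μ(σ)⁻¹ tr ρ̄(σ)` give the trace identity with `ψ̄ := μ`
(`ker μ ⊇ ker ρ̄`); a common eigenvector `u` of `τ̄` would give the common eigenvector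
`T (u₀², −u₀u₁, −u₁²)` of `ρ̄` (`ad_mulVec_eq_smul`), so `τ̄` is irreducible over the algebraically
closed `k`, i.e. absolutely irreducible (Burnside, `span_eq_top_iff_forall_isIrreducible`).
[cite: SerreDurham1977, §6.1 Thm. 4 (Tate) and Corollary] [folklore] -/
theorem stub_twistedAdjointOfGO3 (p : ℕ) [Fact p.Prime] (_h2 : (2 : padicAlgClResidueField p) ≠ 0)
    (ρbar : Field.absoluteGaloisGroup ℚ →* GL (Fin 3) (padicAlgClResidueField p))
    (νbar : Field.absoluteGaloisGroup ℚ →* (padicAlgClResidueField p)ˣ)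
    (A : Matrix (Fin 3) (Fin 3) (padicAlgClResidueField p))
    (hopen : IsOpen ((ρbar.ker : Subgroup (Field.absoluteGaloisGroup ℚ)) :
      Set (Field.absoluteGaloisGroup ℚ)))
    (hirr : IsAbsIrreducible ρbar) (_hsymm : A.IsSymm) (hdet : A.det ≠ 0)
    (hGO : ∀ σ, (ρbar σ).val.transpose * A * (ρbar σ).val = (νbar σ).val • A)
    (hAd : ∀ [IsAlgClosed (padicAlgClResidueField p)],
      ∃ T : GL (Fin 3) (padicAlgClResidueField p),
        (T : Matrix (Fin 3) (Fin 3) (padicAlgClResidueField p)).transpose * A *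
            (T : Matrix (Fin 3) (Fin 3) (padicAlgClResidueField p)) = !![0, 0, 1; 0, 2, 0; 1, 0, 0] ∧
        ∀ M : Matrix (Fin 3) (Fin 3) (padicAlgClResidueField p), M.transpose * A * M = A → M.det = 1 →
          ∃ g : GL (Fin 2) (padicAlgClResidueField p), ∀ v w : Fin 3 → padicAlgClResidueField p,
            w = (((T⁻¹ : GL (Fin 3) (padicAlgClResidueField p)) :
                Matrix (Fin 3) (Fin 3) (padicAlgClResidueField p)) * M *
              (T : Matrix (Fin 3) (Fin 3) (padicAlgClResidueField p))).mulVec v →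
            (g : Matrix (Fin 2) (Fin 2) (padicAlgClResidueField p)) * !![v 1, v 0; v 2, -v 1] *
                ((g⁻¹ : GL (Fin 2) (padicAlgClResidueField p)) :
                  Matrix (Fin 2) (Fin 2) (padicAlgClResidueField p)) =
              !![w 1, w 0; w 2, -w 1]) :
    ∃ (τbar : Field.absoluteGaloisGroup ℚ →* GL (Fin 2) (padicAlgClResidueField p))
      (ψbar : Field.absoluteGaloisGroup ℚ →* (padicAlgClResidueField p)ˣ),
      IsOpen ((τbar.ker : Subgroup (Field.absoluteGaloisGroup ℚ)) : Set (Field.absoluteGaloisGroup ℚ)) ∧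
      IsAbsIrreducible τbar ∧
      IsOpen ((ψbar.ker : Subgroup (Field.absoluteGaloisGroup ℚ)) : Set (Field.absoluteGaloisGroup ℚ)) ∧
      ∀ σ, (ρbar σ).val.trace =
        (ψbar σ).val * ((τbar σ).val.trace ^ 2 * ((τbar σ).val.det)⁻¹ - 1) := by
  classical
  haveI : IsAlgClosed (padicAlgClResidueField p) :=
    Literature.RingTheory.Valuation.isAlgClosed_residueField (padicAlgClIntegers p)
  obtain ⟨T, -, hsurj⟩ := hAd
  -- (a) `det ρ̄(σ)² = ν̄(σ)³` and the square root `μ := det ρ̄ · ν̄⁻¹` of `ν̄`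
  have hdet2 : ∀ σ, Matrix.GeneralLinearGroup.det (ρbar σ) ^ 2 = νbar σ ^ 3 := fun σ => by
    ext
    have h := congrArg Matrix.det (hGO σ)
    rw [Matrix.det_mul, Matrix.det_mul, Matrix.det_transpose, Matrix.det_smul,
      Fintype.card_fin] at h
    rw [Units.val_pow_eq_pow_val, Units.val_pow_eq_pow_val,
      Matrix.GeneralLinearGroup.val_det_apply]
    exact mul_right_cancel₀ hdet (by rw [← h]; ring)
  obtain ⟨μ, hμ⟩ : ∃ μ : Field.absoluteGaloisGroup ℚ →* (padicAlgClResidueField p)ˣ,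
      ∀ σ, μ σ = Matrix.GeneralLinearGroup.det (ρbar σ) * (νbar σ)⁻¹ :=
    ⟨(Matrix.GeneralLinearGroup.det.comp ρbar) * νbar⁻¹, fun σ => rfl⟩
  have hμ2 : ∀ σ, μ σ ^ 2 = νbar σ := fun σ => by
    rw [hμ, mul_pow, hdet2, inv_pow]; group
  have hμ3 : ∀ σ, μ σ ^ 3 = Matrix.GeneralLinearGroup.det (ρbar σ) := fun σ => by
    rw [pow_succ, hμ2, hμ, mul_comm (Matrix.GeneralLinearGroup.det (ρbar σ)), mul_inv_cancel_left]
  have hμ0 : ∀ σ, (μ σ).val ≠ 0 := fun σ => (μ σ).ne_zero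
  have hμ2' : ∀ σ, (μ σ).val ^ 2 = (νbar σ).val := fun σ => by
    rw [← Units.val_pow_eq_pow_val, hμ2]
  have hμ3' : ∀ σ, (μ σ).val ^ 3 = (ρbar σ).val.det := fun σ => by
    rw [← Units.val_pow_eq_pow_val, hμ3, Matrix.GeneralLinearGroup.val_det_apply]
  have hμ1 : ∀ σ, ρbar σ = 1 → μ σ = 1 := fun σ hσ => by
    have hν : νbar σ = 1 := by
      have h := hGO σ
      rw [hσ, Units.val_one, Matrix.transpose_one, Matrix.one_mul, Matrix.mul_one] at h
      by_contra hne
      apply hdet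
      have hA : ((νbar σ).val - 1) • A = 0 := by rw [sub_smul, one_smul, ← h, sub_self]
      rcases smul_eq_zero.mp hA with h1 | h1
      · exact absurd (Units.val_eq_one.mp (sub_eq_zero.mp h1)) hne
      · rw [h1, Matrix.det_zero]
    rw [hμ, hσ, hν, map_one, inv_one, mul_one]
  -- (b) `M_σ := μ(σ)⁻¹ ρ̄(σ) ∈ SO(A)`, its `Ad`-preimage `g_σ`, `N_σ := T⁻¹ M_σ T`
  obtain ⟨M, hM⟩ : ∃ M : Field.absoluteGaloisGroup ℚ → Matrix (Fin 3) (Fin 3) _,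
      ∀ σ, M σ = (μ σ).val⁻¹ • (ρbar σ).val := ⟨_, fun _ => rfl⟩
  have hM1 : ∀ σ, (M σ).transpose * A * M σ = A := fun σ => by
    rw [hM, Matrix.transpose_smul, Matrix.smul_mul, Matrix.smul_mul, Matrix.mul_smul, smul_smul]
    erw [hGO σ]
    rw [smul_smul, ← hμ2']
    have := hμ0 σ
    convert one_smul (padicAlgClResidueField p) A using 2
    field_simp
  have hM2 : ∀ σ, (M σ).det = 1 := fun σ => by
    rw [hM, Matrix.det_smul, Fintype.card_fin, ← hμ3', ← mul_pow, inv_mul_cancel₀ (hμ0 σ), one_pow]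
  choose g hg using fun σ => hsurj (M σ) (hM1 σ) (hM2 σ)
  obtain ⟨N, hN⟩ : ∃ N : Field.absoluteGaloisGroup ℚ → Matrix (Fin 3) (Fin 3) _,
      ∀ σ, N σ = T⁻¹.val * M σ * T.val := ⟨_, fun _ => rfl⟩
  have hgN : ∀ σ (v : Fin 3 → padicAlgClResidueField p),
      (g σ).val * !![v 1, v 0; v 2, -v 1] * (g σ)⁻¹.val =
        !![(N σ).mulVec v 1, (N σ).mulVec v 0; (N σ).mulVec v 2, -(N σ).mulVec v 1] :=
    fun σ v => hg σ v _ (by rw [hN])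
  have hN1 : ∀ σ, ρbar σ = 1 → N σ = 1 := fun σ hσ => by
    rw [hN, hM, hμ1 σ hσ, hσ, Units.val_one, Units.val_one, inv_one, one_smul, Matrix.mul_one,
      Units.inv_mul]
  have hNmul : ∀ σ τ, N (σ * τ) = N σ * N τ := fun σ τ => by
    have hMmul : M (σ * τ) = M σ * M τ := by
      simp only [hM, map_mul, Units.val_mul, mul_inv, Matrix.smul_mul, Matrix.mul_smul, smul_smul]
      exact congrArg (· • _) (mul_comm _ _)
    rw [hN, hN, hN, hMmul]
    simp only [Matrix.mul_assoc]
    rw [Units.mul_inv_cancel_left]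
  -- (c) the projective representation `σ ↦ [g_σ]`; (d) its kernel contains `ker ρ̄`
  obtain ⟨ρt, hρt⟩ : ∃ ρt : Field.absoluteGaloisGroup ℚ →* PGL(2, padicAlgClResidueField p),
      ∀ σ, ρt σ = Matrix.ProjGenLinGroup.mk (g σ) :=
    ⟨{ toFun := fun σ => Matrix.ProjGenLinGroup.mk (g σ)
       map_one' := by
         show Matrix.ProjGenLinGroup.mk (g 1) = 1
         rw [Matrix.ProjGenLinGroup.mk_eq_one]
         exact mem_center_of_conj_eq _ fun v => by
           rw [hgN, hN1 1 (map_one ρbar), Matrix.one_mulVec]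
       map_mul' := fun σ τ => by
         show Matrix.ProjGenLinGroup.mk (g (σ * τ)) =
           Matrix.ProjGenLinGroup.mk (g σ) * Matrix.ProjGenLinGroup.mk (g τ)
         rw [← map_mul]
         exact mk_eq_mk_of_conj_eq _ _ fun v => by
           rw [hgN, hNmul, ← Matrix.mulVec_mulVec, ← hgN σ, ← hgN τ, mul_inv_rev, Units.val_mul,
             Units.val_mul]
           simp only [Matrix.mul_assoc] }, fun σ => rfl⟩
  have hker : IsOpen ((ρt.ker : Subgroup (Field.absoluteGaloisGroup ℚ)) :
      Set (Field.absoluteGaloisGroup ℚ)) := by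
    refine Subgroup.isOpen_mono (H₁ := ρbar.ker) (fun σ hσ => ?_) hopen
    rw [MonoidHom.mem_ker] at hσ ⊢
    rw [hρt, Matrix.ProjGenLinGroup.mk_eq_one]
    exact mem_center_of_conj_eq _ fun v => by rw [hgN, hN1 σ hσ, Matrix.one_mulVec]
  -- (e) Tate's lifting theorem (discrete topology on `k`): `Ad(τ̄ σ) = N_σ` in coordinates
  letI : TopologicalSpace (padicAlgClResidueField p) := ⊥
  haveI : DiscreteTopology (padicAlgClResidueField p) := ⟨rfl⟩
  obtain ⟨τ, hτ⟩ := Tate_projectiveLifting_holds 2 (padicAlgClResidueField p) ρt hker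
  have hτN : ∀ σ (v : Fin 3 → padicAlgClResidueField p),
      (τ σ).val * !![v 1, v 0; v 2, -v 1] * (τ σ)⁻¹.val =
        !![(N σ).mulVec v 1, (N σ).mulVec v 0; (N σ).mulVec v 2, -(N σ).mulVec v 1] :=
    fun σ v => by rw [conj_eq_of_mk_eq ((hτ σ).trans (hρt σ))]; exact hgN σ v
  have hT : ∀ w : Fin 3 → padicAlgClResidueField p, T⁻¹.val.mulVec (T.val.mulVec w) = w :=
    fun w => by rw [Matrix.mulVec_mulVec, Units.inv_mul, Matrix.one_mulVec]
  refine ⟨(τ : Field.absoluteGaloisGroup ℚ →* GL (Fin 2) (padicAlgClResidueField p)), μ,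
    ?_, ?_, Subgroup.isOpen_mono (H₁ := ρbar.ker) (fun σ hσ => ?_) hopen, fun σ => ?_⟩
  · -- open kernel of `τ̄`: preimage of the open point `1` of the discrete `GL₂(k)`
    have h1 : IsOpen ((τ : Field.absoluteGaloisGroup ℚ → GL (Fin 2) (padicAlgClResidueField p)) ⁻¹'
        {1}) := (isOpen_discrete _).preimage (map_continuous τ)
    convert h1 using 1
    ext σ
    simp [MonoidHom.mem_ker]
  · -- (h) absolute irreducibility: irreducibility over the algebraically closed `k` (Burnside)
    have hirrk : (glRepresentation ρbar).IsIrreducible := by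
      have h1 := hirr (padicAlgClResidueField p) (RingHom.id _)
      rwa [Matrix.GeneralLinearGroup.map_id, MonoidHom.id_comp] at h1
    have hirrτ : (toStdRepresentation
        (τ : Field.absoluteGaloisGroup ℚ →* GL (Fin 2) (padicAlgClResidueField p))).IsIrreducible := by
      rw [isIrreducible_iff_not_hasCommonEigenvector]
      rintro ⟨u, hu0, hu⟩
      refine not_isIrreducible_of_common_eigenvector ρbar
        (T.val.mulVec ![u 0 ^ 2, -(u 0 * u 1), -(u 1 ^ 2)]) (fun h0 => ?_) (fun σ => ?_) hirrk
      · have h0' := congrArg T⁻¹.val.mulVec h0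
        rw [hT, Matrix.mulVec_zero] at h0'
        have e0 := congr_fun h0' 0
        have e2 := congr_fun h0' 2
        simp at e0 e2
        apply hu0
        ext i
        fin_cases i <;> simp [e0, e2]
      · obtain ⟨c, hc⟩ := hu σ
        refine ⟨(μ σ).val * (c ^ 2 * ((τ σ).val.det)⁻¹), ?_⟩
        have hρ : (ρbar σ).val = (μ σ).val • (T.val * N σ * T⁻¹.val) := by
          rw [hN, hM, Matrix.mul_assoc T⁻¹.val _ T.val, Units.mul_inv_cancel_left,
            Units.mul_inv_cancel_right, smul_smul, mul_inv_cancel₀ (hμ0 σ), one_smul]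
        rw [hρ, Matrix.smul_mulVec, ← Matrix.mulVec_mulVec, ← Matrix.mulVec_mulVec, hT,
          ad_mulVec_eq_smul (τ σ) (N σ) (hτN σ) u c hc, Matrix.mulVec_smul, smul_smul]
    exact (Literature.RepresentationTheory.Semisimple.span_eq_top_iff_forall_isIrreducible
      two_pos _).mp
      (Literature.RepresentationTheory.Semisimple.span_eq_top_of_isIrreducible (hirr := hirrτ) _)
  · -- (g) open kernel of `ψ̄ = μ`
    rw [MonoidHom.mem_ker] at hσ ⊢
    exact hμ1 σ hσ
  · -- (f) the trace identity
    have h1 := trace_eq_of_conj_eq (τ σ) (N σ) (hτN σ)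
    have h2 : (N σ).trace = (μ σ).val⁻¹ * (ρbar σ).val.trace := by
      rw [hN, Matrix.trace_mul_cycle, Units.mul_inv, Matrix.one_mul, hM, Matrix.trace_smul,
        smul_eq_mul]
    simp only [MonoidHom.coe_coe]
    rw [← h1, h2, mul_inv_cancel_left₀ (hμ0 σ)]

end Summit.Langlands.Langlands.Cruxes.AdjointSeedFromDuality.Birth
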